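import Literature.AlgebraicGeometry.Deformation.SmoothSchemeLiftObstructionCechCocycle
import HarnessLib

/-!
# The Čech obstruction 2-cochain is a cocycle, and changes by a coboundary under a change of lifts
# (Hartshorne, *Deformation Theory*, proof of Thm. 10.2 (a) — scheme level; sequel of `SmoothSchemeLiftObstructionCechCocycle`)

HOME SEED (cell `hodgecm-mathlib`, director s287, F-11 generic row A3b FILE F2, second half; provisional path
`Deformation/SmoothSchemeLiftObstructionCechCocycleIdentity.lean`; NOT filed this run).  Theorems only.  Currency and the
REPRESENTATION clause as in the first half (`θ` represents `u` iff `u(1 ⊗ c) = 1 ⊗ c + t ⊗ θ(dc)`).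

* §5 THE COCYCLE IDENTITY `o_lmn| − o_jmn| + o_jln| − o_jlm| = 0` on every fourfold overlap («On the fourfold
  intersection, these agree, so we get an obstruction `δ₃ ∈ H²(X₀, T⁰ ⊗ J)`»; ★ A3a `obstructionDerivation_cocycle_of_sub_mem`
  on `A' ⊗_k Γ(U j ∩ U l ∩ U m ∩ U n)`, the twelve restrictions agreeing along both routes by ★ F1 uniqueness).
* §6 CHANGE OF LIFTS `o⁽¹⁾ − o = d¹α` (★ A3a §4 `infinitesimalAut_eq_discrepancy_modified`): the class of `o` in the ordered
  Čech complex of `𝒯_{X/k}` does not depend on the lifts.  (`-- TODO(general form)`: coefficients `𝒯 ⊗_k J`; the tree's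
  `Morphisms/CechModule` stops at `Č²`, so the identity is stated as an equation of sections, not as `o ∈ Ž²`.)

HC_CM is proved only modulo the 7 printed citations until rung 0 closes — nothing here bears on a summit statement.

## References
* [Hartshorne2010] R. Hartshorne, *Deformation Theory*, GTM 257, Springer (2010): Thm. 10.2 (a) and its proof (p. 81),
  Remark 10.1.1 (p. 80), Cor. 10.3 (p. 82).
* [Hartshorne1977] R. Hartshorne, *Algebraic Geometry*, GTM 52 (1977): III §4 p. 218, II.5 p. 109, II.8 p. 180.
-/

noncomputable section

-- `TopCat.Presheaf`/`TopCat.Sheaf` are not reducible (as in Mathlib's `AlgebraicGeometry/Modules`).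
set_option backward.isDefEq.respectTransparency false

open CategoryTheory AlgebraicGeometry Opposite TopologicalSpace
open scoped TensorProduct

universe u

namespace Literature.AlgebraicGeometry.Deformation

open Literature.AlgebraicGeometry.HodgeTheory Literature.AlgebraicGeometry.Modules
  Literature.AlgebraicGeometry.Motives Literature.AlgebraicGeometry.Morphisms SmoothAffineDeformation

variable {k : Type u} [Field k] {X : Over (Spec (CommRingCat.of k))}
  [instΓ : ∀ W : X.left.Opens, Algebra k Γ(X.left, W)]
  (halg : ∀ (W : X.left.Opens) (s : k), algebraMap k Γ(X.left, W) s = (constToPresheaf X).app (op W) s)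
  {A' : Type u} [CommRing A'] [Algebra k A']

/-! ## §5 The cocycle identity -/

section Cocycle

variable (J 𝔫' : Ideal A') (hJ : J * J = ⊥) (hJ𝔫 : J * 𝔫' = ⊥) (e : ↥(J.restrictScalars k) ≃ₗ[k] k)

omit instΓ in
/-- `(θ − θ')(s) = θ(s) − θ'(s)`. [cite: Hartshorne1977, II.5 (sheaf Hom, p. 109)] -/
theorem appLE_sub {W : X.left.Opens} (θ θ' : (cotangentSheaf X).over W ⟶ (unitModule X.left).over W)
    (s : Γ(cotangentSheaf X, W)) : appLE (θ - θ') (𝟙 W) s = appLE θ (𝟙 W) s - appLE θ' (𝟙 W) s := by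
  rw [eq_sub_iff_add_eq, ← appLE_add, sub_add_cancel]

include hJ hJ𝔫 in
/-- **The cocycle identity on one quadruple-overlap ring** (★ A3a `obstructionDerivation_cocycle_of_sub_mem`, read on
representing sections): over an affine `W`, if `θ₁₂₃, θ₁₂₄, θ₁₃₄, θ₂₃₄` represent the four discrepancies
`σ_yz σ_xy σ_xz⁻¹` (each `≡ 1 (mod J)`) of six automorphisms `σ_xy` of `A' ⊗_k Γ(W)` with `σ₃₄ ≡ 1 (mod 𝔫')`, `J𝔫' = 0`,
then `θ₂₃₄ − θ₁₃₄ + θ₁₂₄ − θ₁₂₃ = 0`. [cite: Hartshorne2010, Thm. 10.2 (proof), p. 81 («on the fourfold intersection, these agree»)] -/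
theorem tangentSheaf_section_rep_cocycle {W : X.left.Opens} (hW : IsAffineOpen W)
    {σ₁₂ σ₁₃ σ₁₄ σ₂₃ σ₂₄ σ₃₄ : A' ⊗[k] Γ(X.left, W) ≃ₐ[A'] A' ⊗[k] Γ(X.left, W)}
    (hσ₃₄ : ∀ x, σ₃₄ x - x ∈ 𝔫' • (⊤ : Submodule A' (A' ⊗[k] Γ(X.left, W))))
    (h₁₂₃ : ∀ x, (σ₂₃ * σ₁₂ * σ₁₃⁻¹) x - x ∈ J • (⊤ : Submodule A' (A' ⊗[k] Γ(X.left, W))))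
    (h₁₂₄ : ∀ x, (σ₂₄ * σ₁₂ * σ₁₄⁻¹) x - x ∈ J • (⊤ : Submodule A' (A' ⊗[k] Γ(X.left, W))))
    (h₁₃₄ : ∀ x, (σ₃₄ * σ₁₃ * σ₁₄⁻¹) x - x ∈ J • (⊤ : Submodule A' (A' ⊗[k] Γ(X.left, W))))
    (h₂₃₄ : ∀ x, (σ₃₄ * σ₂₃ * σ₂₄⁻¹) x - x ∈ J • (⊤ : Submodule A' (A' ⊗[k] Γ(X.left, W))))
    {θ₁₂₃ θ₁₂₄ θ₁₃₄ θ₂₃₄ : (cotangentSheaf X).over W ⟶ (unitModule X.left).over W}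
    (hθ₁₂₃ : ∀ c : Γ(X.left, W), (σ₂₃ * σ₁₂ * σ₁₃⁻¹) ((1 : A') ⊗ₜ c) =
        (1 : A') ⊗ₜ c + ((e.symm 1 : ↥(J.restrictScalars k)) : A') ⊗ₜ
          (show Γ(X.left, W) from appLE θ₁₂₃ (𝟙 W) (dSection X W c)))
    (hθ₁₂₄ : ∀ c : Γ(X.left, W), (σ₂₄ * σ₁₂ * σ₁₄⁻¹) ((1 : A') ⊗ₜ c) =
        (1 : A') ⊗ₜ c + ((e.symm 1 : ↥(J.restrictScalars k)) : A') ⊗ₜ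
          (show Γ(X.left, W) from appLE θ₁₂₄ (𝟙 W) (dSection X W c)))
    (hθ₁₃₄ : ∀ c : Γ(X.left, W), (σ₃₄ * σ₁₃ * σ₁₄⁻¹) ((1 : A') ⊗ₜ c) =
        (1 : A') ⊗ₜ c + ((e.symm 1 : ↥(J.restrictScalars k)) : A') ⊗ₜ
          (show Γ(X.left, W) from appLE θ₁₃₄ (𝟙 W) (dSection X W c)))
    (hθ₂₃₄ : ∀ c : Γ(X.left, W), (σ₃₄ * σ₂₃ * σ₂₄⁻¹) ((1 : A') ⊗ₜ c) =
        (1 : A') ⊗ₜ c + ((e.symm 1 : ↥(J.restrictScalars k)) : A') ⊗ₜ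
          (show Γ(X.left, W) from appLE θ₂₃₄ (𝟙 W) (dSection X W c))) :
    θ₂₃₄ - θ₁₃₄ + θ₁₂₄ - θ₁₂₃ = 0 := by
  obtain ⟨D₁₂₃, hD₁₂₃⟩ := (exists_eq_infinitesimalAut_iff J hJ _).2 h₁₂₃
  obtain ⟨D₁₂₄, hD₁₂₄⟩ := (exists_eq_infinitesimalAut_iff J hJ _).2 h₁₂₄
  obtain ⟨D₁₃₄, hD₁₃₄⟩ := (exists_eq_infinitesimalAut_iff J hJ _).2 h₁₃₄
  obtain ⟨D₂₃₄, hD₂₃₄⟩ := (exists_eq_infinitesimalAut_iff J hJ _).2 h₂₃₄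
  have hD := obstructionDerivation_cocycle_of_sub_mem J hJ hJ𝔫 hσ₃₄ hD₁₂₃ hD₁₂₄ hD₁₃₄ hD₂₃₄
  have e₁₂₃ := (rep_iff_forall_eq_tmul J hJ e hD₁₂₃ θ₁₂₃).1 hθ₁₂₃
  have e₁₂₄ := (rep_iff_forall_eq_tmul J hJ e hD₁₂₄ θ₁₂₄).1 hθ₁₂₄
  have e₁₃₄ := (rep_iff_forall_eq_tmul J hJ e hD₁₃₄ θ₁₃₄).1 hθ₁₃₄
  have e₂₃₄ := (rep_iff_forall_eq_tmul J hJ e hD₂₃₄ θ₂₃₄).1 hθ₂₃₄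
  refine (tangentSheaf_section_eq_zero_iff_of_isAffineOpen hW _).2 fun c => ?_
  have hc := congrArg (fun D : Derivation k Γ(X.left, W) (Γ(X.left, W) ⊗[k] ↥(J.restrictScalars k)) => D c) hD
  simp only [Derivation.sub_apply, Derivation.add_apply, Derivation.zero_apply, e₁₂₃, e₁₂₄, e₁₃₄, e₂₃₄,
    ← TensorProduct.sub_tmul, ← TensorProduct.add_tmul] at hc
  rw [← TensorProduct.zero_tmul Γ(X.left, W) (e.symm 1)] at hc
  have hc' := tmul_symm_one_injective J e hc
  rw [appLE_sub, appLE_add, appLE_sub]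
  exact hc'


/-- **A represented automorphism is `≡ 1 (mod J)`** (the clause on the `1 ⊗ c` extends `A'`-linearly).
[cite: Hartshorne2010, Remark 10.1.1, p. 80] -/
theorem sub_mem_of_rep {W : X.left.Opens} {u : A' ⊗[k] Γ(X.left, W) ≃ₐ[A'] A' ⊗[k] Γ(X.left, W)}
    {θ : (cotangentSheaf X).over W ⟶ (unitModule X.left).over W}
    (hθ : ∀ c : Γ(X.left, W), u ((1 : A') ⊗ₜ c) =
        (1 : A') ⊗ₜ c + ((e.symm 1 : ↥(J.restrictScalars k)) : A') ⊗ₜ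
          (show Γ(X.left, W) from appLE θ (𝟙 W) (dSection X W c))) (y : A' ⊗[k] Γ(X.left, W)) :
    u y - y ∈ J • (⊤ : Submodule A' (A' ⊗[k] Γ(X.left, W))) := by
  induction y using TensorProduct.induction_on with
  | zero => rw [map_zero, sub_zero]; exact Submodule.zero_mem _
  | tmul a c =>
    have hac : (a ⊗ₜ[k] c : A' ⊗[k] Γ(X.left, W)) = a • ((1 : A') ⊗ₜ[k] c) := by
      rw [TensorProduct.smul_tmul', smul_eq_mul, mul_one]
    rw [hac, map_smul, hθ, smul_add, add_sub_cancel_left, ← idealTensorIncl_tmul]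
    exact Submodule.smul_mem _ a (idealTensorIncl_mem J _)
  | add x y hx hy =>
    have hxy : u (x + y) - (x + y) = (u x - x) + (u y - y) := by rw [map_add]; abel
    rw [hxy]
    exact Submodule.add_mem _ hx hy

include halg in
/-- **Restrictions along two routes agree**: if `W₄ = D(f) ⊆ V` (`f ∈ Γ(V)`, `V` affine) lies in two intermediate opens
`W₃, W₃' ⊆ V`, `ρ, ρ'` restrict `u` to them and `σ` restricts `ρ` to `W₄`, then `σ` also restricts `ρ'` (both routes
restrict `u` along `V → W₄`, ★ F1 uniqueness). [cite: Hartshorne2010, Thm. 10.2 (proof), p. 81] -/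
theorem compat_of_restrict_of_restrict {V W₃ W₃' W₄ : X.left.Opens} (hV : IsAffineOpen V) (f : Γ(X.left, V))
    (hW₄ : W₄ = X.left.basicOpen f) (h₃ : W₃ ≤ V) (h₃' : W₃' ≤ V) (h₄ : W₄ ≤ W₃) (h₄' : W₄ ≤ W₃')
    (hW₃'aff : IsAffineOpen W₃') (f' : Γ(X.left, W₃')) (hW₄' : W₄ = X.left.basicOpen f') (h𝔫 : IsNilpotent 𝔫')
    (u : A' ⊗[k] Γ(X.left, V) ≃ₐ[A'] A' ⊗[k] Γ(X.left, V))
    {Φ₃ : A' ⊗[k] Γ(X.left, V) →ₐ[A'] A' ⊗[k] Γ(X.left, W₃)}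
    (hΦ₃ : ∀ a s, Φ₃ (a ⊗ₜ s) = a ⊗ₜ X.left.presheaf.map (homOfLE h₃).op s)
    {Φ₃' : A' ⊗[k] Γ(X.left, V) →ₐ[A'] A' ⊗[k] Γ(X.left, W₃')}
    (hΦ₃' : ∀ a s, Φ₃' (a ⊗ₜ s) = a ⊗ₜ X.left.presheaf.map (homOfLE h₃').op s)
    {Φ₄ : A' ⊗[k] Γ(X.left, W₃) →ₐ[A'] A' ⊗[k] Γ(X.left, W₄)}
    (hΦ₄ : ∀ a s, Φ₄ (a ⊗ₜ s) = a ⊗ₜ X.left.presheaf.map (homOfLE h₄).op s)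
    {Φ₄' : A' ⊗[k] Γ(X.left, W₃') →ₐ[A'] A' ⊗[k] Γ(X.left, W₄)}
    (hΦ₄' : ∀ a s, Φ₄' (a ⊗ₜ s) = a ⊗ₜ X.left.presheaf.map (homOfLE h₄').op s)
    {ρ : A' ⊗[k] Γ(X.left, W₃) ≃ₐ[A'] A' ⊗[k] Γ(X.left, W₃)} (hρ : ∀ x, ρ (Φ₃ x) = Φ₃ (u x))
    {ρ' : A' ⊗[k] Γ(X.left, W₃') ≃ₐ[A'] A' ⊗[k] Γ(X.left, W₃')} (hρ' : ∀ x, ρ' (Φ₃' x) = Φ₃' (u x))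
    (hρ'𝔫 : ∀ y, ρ' y - y ∈ 𝔫' • (⊤ : Submodule A' (A' ⊗[k] Γ(X.left, W₃'))))
    {σ : A' ⊗[k] Γ(X.left, W₄) ≃ₐ[A'] A' ⊗[k] Γ(X.left, W₄)} (hσ : ∀ y, σ (Φ₄ y) = Φ₄ (ρ y)) :
    ∀ y, σ (Φ₄' y) = Φ₄' (ρ' y) := by
  -- the restriction of `ρ'` to `W₄` (★ F1) …
  obtain ⟨σ', hσ', -⟩ := exists_algEquiv_restrict halg 𝔫' hW₃'aff f' hW₄' h₄' h𝔫 ρ' hρ'𝔫 hΦ₄'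
  -- … and `σ` both restrict `u` along `V → W₄`
  obtain ⟨Φ, hΦ⟩ := exists_baseChangeMap (A' := A') halg V W₄ (h₄.trans h₃)
  have hσu : ∀ x, σ (Φ x) = Φ (u x) := fun x => by
    rw [← baseChangeMap_comp_apply h₃ h₄ hΦ₃ hΦ₄ hΦ, hσ, hρ, baseChangeMap_comp_apply h₃ h₄ hΦ₃ hΦ₄ hΦ]
  have hσ'u : ∀ x, σ' (Φ x) = Φ (u x) := fun x => by
    rw [← baseChangeMap_comp_apply h₃' h₄' hΦ₃' hΦ₄' hΦ, hσ', hρ', baseChangeMap_comp_apply h₃' h₄' hΦ₃' hΦ₄' hΦ]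
  rw [algEquiv_restrict_unique halg hV f hW₄ (h₄.trans h₃) u hΦ hσu hσ'u]
  exact hσ'

include halg hJ in
/-- **The restricted representing section represents the restricted discrepancy**: over an affine `W₃` with
`W₄ = D(f) ⊆ W₃`, if `θ` represents `ρ₂ ρ₁ ρ₃⁻¹` and `σᵢ` restricts `ρᵢ` to `W₄`, then `θ|_{W₄}` represents
`σ₂ σ₁ σ₃⁻¹` (compatibility passes to the discrepancy; it stays `≡ 1 (mod J)` by ★ F1 uniqueness; §3).
[cite: Hartshorne2010, Thm. 10.2 (proof), p. 81] -/
theorem tangentSheaf_section_rep_restrict_discrepancy {W₃ W₄ : X.left.Opens} (hW₃ : IsAffineOpen W₃)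
    (f : Γ(X.left, W₃)) (hW₄ : W₄ = X.left.basicOpen f) (h₄ : W₄ ≤ W₃)
    {ρ₁ ρ₂ ρ₃ : A' ⊗[k] Γ(X.left, W₃) ≃ₐ[A'] A' ⊗[k] Γ(X.left, W₃)}
    {θ : (cotangentSheaf X).over W₃ ⟶ (unitModule X.left).over W₃}
    (hθ : ∀ c : Γ(X.left, W₃), (ρ₂ * ρ₁ * ρ₃⁻¹) ((1 : A') ⊗ₜ c) =
        (1 : A') ⊗ₜ c + ((e.symm 1 : ↥(J.restrictScalars k)) : A') ⊗ₜ
          (show Γ(X.left, W₃) from appLE θ (𝟙 W₃) (dSection X W₃ c)))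
    {Φ₄ : A' ⊗[k] Γ(X.left, W₃) →ₐ[A'] A' ⊗[k] Γ(X.left, W₄)}
    (hΦ₄ : ∀ a s, Φ₄ (a ⊗ₜ s) = a ⊗ₜ X.left.presheaf.map (homOfLE h₄).op s)
    {σ₁ σ₂ σ₃ : A' ⊗[k] Γ(X.left, W₄) ≃ₐ[A'] A' ⊗[k] Γ(X.left, W₄)}
    (hσ₁ : ∀ y, σ₁ (Φ₄ y) = Φ₄ (ρ₁ y)) (hσ₂ : ∀ y, σ₂ (Φ₄ y) = Φ₄ (ρ₂ y)) (hσ₃ : ∀ y, σ₃ (Φ₄ y) = Φ₄ (ρ₃ y)) :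
    ∀ c : Γ(X.left, W₄), (σ₂ * σ₁ * σ₃⁻¹) ((1 : A') ⊗ₜ c) =
        (1 : A') ⊗ₜ c + ((e.symm 1 : ↥(J.restrictScalars k)) : A') ⊗ₜ
          (show Γ(X.left, W₄) from appLE (restrictHom (homOfLE h₄) θ) (𝟙 W₄) (dSection X W₄ c)) := by
  have hJnil : IsNilpotent J := ⟨2, by rw [pow_two, hJ]; rfl⟩
  -- the discrepancy of the restrictions restricts the discrepancy
  have hδ : ∀ y, (σ₂ * σ₁ * σ₃⁻¹) (Φ₄ y) = Φ₄ ((ρ₂ * ρ₁ * ρ₃⁻¹) y) := fun y =>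
    algEquiv_restrict_mul (algEquiv_restrict_mul hσ₂ hσ₁) (algEquiv_restrict_inv hσ₃) y
  -- it is `≡ 1 (mod J)`: the `J`-restriction of the discrepancy exists and is unique
  obtain ⟨δ', hδ', hδ'J⟩ := exists_algEquiv_restrict halg J hW₃ f hW₄ h₄ hJnil (ρ₂ * ρ₁ * ρ₃⁻¹)
    (sub_mem_of_rep J e hθ) hΦ₄
  have heq : σ₂ * σ₁ * σ₃⁻¹ = δ' := algEquiv_restrict_unique halg hW₃ f hW₄ h₄ (ρ₂ * ρ₁ * ρ₃⁻¹) hΦ₄ hδ hδ'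
  have hδJ : ∀ y, (σ₂ * σ₁ * σ₃⁻¹) y - y ∈ J • (⊤ : Submodule A' (A' ⊗[k] Γ(X.left, W₄))) := heq ▸ hδ'J
  exact tangentSheaf_section_rep_restrict halg J hJ e hW₃ f hW₄ h₄ hθ hΦ₄ hδ hδJ


variable {ι : Type u} (U : ι → X.left.affineOpens) (b : (j l : ι) → Γ(X.left, (U j).1))
  (hb : ∀ j l, (U j).1 ⊓ (U l).1 = X.left.basicOpen (b j l))

include halg hb hJ hJ𝔫 in
/-- **THE OBSTRUCTION COCHAIN IS A 2-COCYCLE** («On the fourfold intersection, these agree»): for every `j l m n`,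
`o_lmn| − o_jmn| + o_jln| − o_jlm| = 0` in `Γ(U j ∩ U l ∩ U m ∩ U n, 𝒯_{X/k})` (the `d²` of the ordered Čech complex),
for any cochain `o` representing the triple-overlap discrepancies of the lifted transition automorphisms `ψ` (§4).
Proof: restrict the twelve `ρ`'s to the fourfold overlap (★ F1; the two routes through the two triples containing a pair
agree), read the four restricted `o`'s as representing the four discrepancies of SIX automorphisms of
`A' ⊗_k Γ(U j ∩ U l ∩ U m ∩ U n)` (§3), and apply the ring-level identity ★ A3a `obstructionDerivation_cocycle_of_sub_mem`.
[cite: Hartshorne2010, Thm. 10.2 (proof), p. 81] [cite: Hartshorne2010, Cor. 10.3, p. 82] -/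
theorem obstructionCochain_cocycle (h𝔫 : IsNilpotent 𝔫')
    (ψ : (j l : ι) → A' ⊗[k] Γ(X.left, (U j).1 ⊓ (U l).1) ≃ₐ[A'] A' ⊗[k] Γ(X.left, (U j).1 ⊓ (U l).1))
    (hψ : ∀ j l x, ψ j l x - x ∈ 𝔫' • (⊤ : Submodule A' (A' ⊗[k] Γ(X.left, (U j).1 ⊓ (U l).1))))
    (o : CechMC2 X.hom (tangentSheaf X) (fun j => (U j).1))
    (ho : ∀ (j l m : ι)
      (Φjl : A' ⊗[k] Γ(X.left, (U j).1 ⊓ (U l).1) →ₐ[A'] A' ⊗[k] Γ(X.left, (U j).1 ⊓ (U l).1 ⊓ (U m).1))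
      (_ : ∀ a s, Φjl (a ⊗ₜ s) = a ⊗ₜ X.left.presheaf.map (homOfLE inf_le_left).op s)
      (Φlm : A' ⊗[k] Γ(X.left, (U l).1 ⊓ (U m).1) →ₐ[A'] A' ⊗[k] Γ(X.left, (U j).1 ⊓ (U l).1 ⊓ (U m).1))
      (_ : ∀ a s, Φlm (a ⊗ₜ s) = a ⊗ₜ X.left.presheaf.map
        (homOfLE (le_inf (inf_le_left.trans inf_le_right) inf_le_right)).op s)
      (Φjm : A' ⊗[k] Γ(X.left, (U j).1 ⊓ (U m).1) →ₐ[A'] A' ⊗[k] Γ(X.left, (U j).1 ⊓ (U l).1 ⊓ (U m).1))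
      (_ : ∀ a s, Φjm (a ⊗ₜ s) = a ⊗ₜ X.left.presheaf.map
        (homOfLE (le_inf (inf_le_left.trans inf_le_left) inf_le_right)).op s)
      (ρjl ρlm ρjm : A' ⊗[k] Γ(X.left, (U j).1 ⊓ (U l).1 ⊓ (U m).1) ≃ₐ[A']
        A' ⊗[k] Γ(X.left, (U j).1 ⊓ (U l).1 ⊓ (U m).1)),
      (∀ x, ρjl (Φjl x) = Φjl (ψ j l x)) → (∀ x, ρlm (Φlm x) = Φlm (ψ l m x)) →
      (∀ x, ρjm (Φjm x) = Φjm (ψ j m x)) →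
      ∀ c : Γ(X.left, (U j).1 ⊓ (U l).1 ⊓ (U m).1), (ρlm * ρjl * ρjm⁻¹) ((1 : A') ⊗ₜ c) =
        (1 : A') ⊗ₜ c + ((e.symm 1 : ↥(J.restrictScalars k)) : A') ⊗ₜ
          (show Γ(X.left, (U j).1 ⊓ (U l).1 ⊓ (U m).1) from appLE (o j l m) (𝟙 _) (dSection X _ c)))
    (j l m n : ι) :
    MSections.res X.hom (tangentSheaf X)
        (le_inf (le_inf (inf_le_left.trans (inf_le_left.trans inf_le_right)) (inf_le_left.trans inf_le_right))
          inf_le_right : (U j).1 ⊓ (U l).1 ⊓ (U m).1 ⊓ (U n).1 ≤ (U l).1 ⊓ (U m).1 ⊓ (U n).1) (o l m n) -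
      MSections.res X.hom (tangentSheaf X)
        (le_inf (le_inf (inf_le_left.trans (inf_le_left.trans inf_le_left)) (inf_le_left.trans inf_le_right))
          inf_le_right : (U j).1 ⊓ (U l).1 ⊓ (U m).1 ⊓ (U n).1 ≤ (U j).1 ⊓ (U m).1 ⊓ (U n).1) (o j m n) +
      MSections.res X.hom (tangentSheaf X)
        (le_inf (inf_le_left.trans inf_le_left) inf_le_right :
          (U j).1 ⊓ (U l).1 ⊓ (U m).1 ⊓ (U n).1 ≤ (U j).1 ⊓ (U l).1 ⊓ (U n).1) (o j l n) -
      MSections.res X.hom (tangentSheaf X)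
        (inf_le_left : (U j).1 ⊓ (U l).1 ⊓ (U m).1 ⊓ (U n).1 ≤ (U j).1 ⊓ (U l).1 ⊓ (U m).1) (o j l m) = 0 := by
  classical
  -- §4 data once more: the triple overlaps are principal in the pairwise ones; base changes; restrictions
  have hW₃jl : ∀ j l m : ι, (U j).1 ⊓ (U l).1 ⊓ (U m).1 =
      X.left.basicOpen (X.left.presheaf.map (homOfLE (inf_le_left : (U j).1 ⊓ (U l).1 ≤ (U j).1)).op (b j m)) :=
    fun j l m => inf_eq_basicOpen_map U b hb inf_le_left m
  have hW₃lm : ∀ j l m : ι, (U j).1 ⊓ (U l).1 ⊓ (U m).1 =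
      X.left.basicOpen (X.left.presheaf.map (homOfLE (inf_le_left : (U l).1 ⊓ (U m).1 ≤ (U l).1)).op (b l j)) :=
    fun j l m => by
      rw [← inf_eq_basicOpen_map U b hb inf_le_left j]
      ac_rfl
  have hW₃jm : ∀ j l m : ι, (U j).1 ⊓ (U l).1 ⊓ (U m).1 =
      X.left.basicOpen (X.left.presheaf.map (homOfLE (inf_le_left : (U j).1 ⊓ (U m).1 ≤ (U j).1)).op (b j l)) :=
    fun j l m => by
      rw [← inf_eq_basicOpen_map U b hb inf_le_left l]
      ac_rfl
  have hΦjl := fun j l m : ι => exists_baseChangeMap (A' := A') halg ((U j).1 ⊓ (U l).1)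
    ((U j).1 ⊓ (U l).1 ⊓ (U m).1) inf_le_left
  have hΦlm := fun j l m : ι => exists_baseChangeMap (A' := A') halg ((U l).1 ⊓ (U m).1)
    ((U j).1 ⊓ (U l).1 ⊓ (U m).1) (le_inf (inf_le_left.trans inf_le_right) inf_le_right)
  have hΦjm := fun j l m : ι => exists_baseChangeMap (A' := A') halg ((U j).1 ⊓ (U m).1)
    ((U j).1 ⊓ (U l).1 ⊓ (U m).1) (le_inf (inf_le_left.trans inf_le_left) inf_le_right)
  choose Φjl hΦjl using hΦjl
  choose Φlm hΦlm using hΦlm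
  choose Φjm hΦjm using hΦjm
  have hρjl := fun j l m : ι => exists_algEquiv_restrict halg 𝔫' (isAffineOpen_inf₂ U b hb j l) _ (hW₃jl j l m)
    inf_le_left h𝔫 (ψ j l) (hψ j l) (hΦjl j l m)
  have hρlm := fun j l m : ι => exists_algEquiv_restrict halg 𝔫' (isAffineOpen_inf₂ U b hb l m) _ (hW₃lm j l m)
    (le_inf (inf_le_left.trans inf_le_right) inf_le_right) h𝔫 (ψ l m) (hψ l m) (hΦlm j l m)
  have hρjm := fun j l m : ι => exists_algEquiv_restrict halg 𝔫' (isAffineOpen_inf₂ U b hb j m) _ (hW₃jm j l m)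
    (le_inf (inf_le_left.trans inf_le_left) inf_le_right) h𝔫 (ψ j m) (hψ j m) (hΦjm j l m)
  choose ρjl hρjl hρjl𝔫 using hρjl
  choose ρlm hρlm hρlm𝔫 using hρlm
  choose ρjm hρjm hρjm𝔫 using hρjm
  have hθ : ∀ x y z : ι, ∀ c, (ρlm x y z * ρjl x y z * (ρjm x y z)⁻¹) ((1 : A') ⊗ₜ c) =
      (1 : A') ⊗ₜ c + ((e.symm 1 : ↥(J.restrictScalars k)) : A') ⊗ₜ
        (show Γ(X.left, (U x).1 ⊓ (U y).1 ⊓ (U z).1) from appLE (o x y z) (𝟙 _) (dSection X _ c)) :=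
    fun x y z => ho x y z (Φjl x y z) (hΦjl x y z) (Φlm x y z) (hΦlm x y z) (Φjm x y z) (hΦjm x y z)
      (ρjl x y z) (ρlm x y z) (ρjm x y z) (hρjl x y z) (hρlm x y z) (hρjm x y z)
  -- the fourfold overlap `W₄` is principal in the four triple overlaps and in the six pairwise ones
  set W₄ : X.left.Opens := (U j).1 ⊓ (U l).1 ⊓ (U m).1 ⊓ (U n).1 with hW₄def
  have hW₄aff : IsAffineOpen W₄ := isAffineOpen_inf₄ U b hb j l m n
  have le_jlm : W₄ ≤ (U j).1 ⊓ (U l).1 ⊓ (U m).1 := inf_le_left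
  have le_jln : W₄ ≤ (U j).1 ⊓ (U l).1 ⊓ (U n).1 := le_inf (inf_le_left.trans inf_le_left) inf_le_right
  have le_jmn : W₄ ≤ (U j).1 ⊓ (U m).1 ⊓ (U n).1 :=
    le_inf (le_inf (inf_le_left.trans (inf_le_left.trans inf_le_left)) (inf_le_left.trans inf_le_right)) inf_le_right
  have le_lmn : W₄ ≤ (U l).1 ⊓ (U m).1 ⊓ (U n).1 :=
    le_inf (le_inf (inf_le_left.trans (inf_le_left.trans inf_le_right)) (inf_le_left.trans inf_le_right)) inf_le_right
  have h4jlm : W₄ = X.left.basicOpen (X.left.presheaf.map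
      (homOfLE (inf_le_left.trans inf_le_left : (U j).1 ⊓ (U l).1 ⊓ (U m).1 ≤ (U j).1)).op (b j n)) :=
    inf_eq_basicOpen_map U b hb _ n
  have h4jln : W₄ = X.left.basicOpen (X.left.presheaf.map
      (homOfLE (inf_le_left.trans inf_le_left : (U j).1 ⊓ (U l).1 ⊓ (U n).1 ≤ (U j).1)).op (b j m)) := by
    rw [← inf_eq_basicOpen_map U b hb _ m, hW₄def]; ac_rfl
  have h4jmn : W₄ = X.left.basicOpen (X.left.presheaf.map
      (homOfLE (inf_le_left.trans inf_le_left : (U j).1 ⊓ (U m).1 ⊓ (U n).1 ≤ (U j).1)).op (b j l)) := by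
    rw [← inf_eq_basicOpen_map U b hb _ l, hW₄def]; ac_rfl
  have h4lmn : W₄ = X.left.basicOpen (X.left.presheaf.map
      (homOfLE (inf_le_left.trans inf_le_left : (U l).1 ⊓ (U m).1 ⊓ (U n).1 ≤ (U l).1)).op (b l j)) := by
    rw [← inf_eq_basicOpen_map U b hb _ j, hW₄def]; ac_rfl
  have h4jl : W₄ = X.left.basicOpen
      (X.left.presheaf.map (homOfLE (inf_le_left : (U j).1 ⊓ (U l).1 ≤ (U j).1)).op (b j m) *
        X.left.presheaf.map (homOfLE (inf_le_left : (U j).1 ⊓ (U l).1 ≤ (U j).1)).op (b j n)) := by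
    rw [← inf_inf_eq_basicOpen_map U b hb _ m n, hW₄def]
  have h4jm : W₄ = X.left.basicOpen
      (X.left.presheaf.map (homOfLE (inf_le_left : (U j).1 ⊓ (U m).1 ≤ (U j).1)).op (b j l) *
        X.left.presheaf.map (homOfLE (inf_le_left : (U j).1 ⊓ (U m).1 ≤ (U j).1)).op (b j n)) := by
    rw [← inf_inf_eq_basicOpen_map U b hb _ l n, hW₄def]; ac_rfl
  have h4jn : W₄ = X.left.basicOpen
      (X.left.presheaf.map (homOfLE (inf_le_left : (U j).1 ⊓ (U n).1 ≤ (U j).1)).op (b j l) *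
        X.left.presheaf.map (homOfLE (inf_le_left : (U j).1 ⊓ (U n).1 ≤ (U j).1)).op (b j m)) := by
    rw [← inf_inf_eq_basicOpen_map U b hb _ l m, hW₄def]; ac_rfl
  have h4lm : W₄ = X.left.basicOpen
      (X.left.presheaf.map (homOfLE (inf_le_left : (U l).1 ⊓ (U m).1 ≤ (U l).1)).op (b l j) *
        X.left.presheaf.map (homOfLE (inf_le_left : (U l).1 ⊓ (U m).1 ≤ (U l).1)).op (b l n)) := by
    rw [← inf_inf_eq_basicOpen_map U b hb _ j n, hW₄def]; ac_rfl
  have h4ln : W₄ = X.left.basicOpen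
      (X.left.presheaf.map (homOfLE (inf_le_left : (U l).1 ⊓ (U n).1 ≤ (U l).1)).op (b l j) *
        X.left.presheaf.map (homOfLE (inf_le_left : (U l).1 ⊓ (U n).1 ≤ (U l).1)).op (b l m)) := by
    rw [← inf_inf_eq_basicOpen_map U b hb _ j m, hW₄def]; ac_rfl
  have h4mn : W₄ = X.left.basicOpen
      (X.left.presheaf.map (homOfLE (inf_le_left : (U m).1 ⊓ (U n).1 ≤ (U m).1)).op (b m j) *
        X.left.presheaf.map (homOfLE (inf_le_left : (U m).1 ⊓ (U n).1 ≤ (U m).1)).op (b m l)) := by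
    rw [← inf_inf_eq_basicOpen_map U b hb _ j l, hW₄def]; ac_rfl
  -- base changes from the four triple overlaps to `W₄`
  obtain ⟨Ξjlm, hΞjlm⟩ := exists_baseChangeMap (A' := A') halg _ W₄ le_jlm
  obtain ⟨Ξjln, hΞjln⟩ := exists_baseChangeMap (A' := A') halg _ W₄ le_jln
  obtain ⟨Ξjmn, hΞjmn⟩ := exists_baseChangeMap (A' := A') halg _ W₄ le_jmn
  obtain ⟨Ξlmn, hΞlmn⟩ := exists_baseChangeMap (A' := A') halg _ W₄ le_lmn
  -- the six restrictions to `W₄` (each from one chosen triple)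
  obtain ⟨σjl, hσjl, -⟩ := exists_algEquiv_restrict halg 𝔫' (isAffineOpen_inf₃ U b hb j l m) _ h4jlm le_jlm h𝔫
    (ρjl j l m) (hρjl𝔫 j l m) hΞjlm
  obtain ⟨σlm, hσlm, -⟩ := exists_algEquiv_restrict halg 𝔫' (isAffineOpen_inf₃ U b hb j l m) _ h4jlm le_jlm h𝔫
    (ρlm j l m) (hρlm𝔫 j l m) hΞjlm
  obtain ⟨σjm, hσjm, -⟩ := exists_algEquiv_restrict halg 𝔫' (isAffineOpen_inf₃ U b hb j l m) _ h4jlm le_jlm h𝔫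
    (ρjm j l m) (hρjm𝔫 j l m) hΞjlm
  obtain ⟨σjn, hσjn, -⟩ := exists_algEquiv_restrict halg 𝔫' (isAffineOpen_inf₃ U b hb j l n) _ h4jln le_jln h𝔫
    (ρjm j l n) (hρjm𝔫 j l n) hΞjln
  obtain ⟨σln, hσln, -⟩ := exists_algEquiv_restrict halg 𝔫' (isAffineOpen_inf₃ U b hb j l n) _ h4jln le_jln h𝔫
    (ρlm j l n) (hρlm𝔫 j l n) hΞjln
  obtain ⟨σmn, hσmn, hσmn𝔫⟩ := exists_algEquiv_restrict halg 𝔫' (isAffineOpen_inf₃ U b hb j m n) _ h4jmn le_jmn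
    h𝔫 (ρlm j m n) (hρlm𝔫 j m n) hΞjmn
  -- the second routes: `σjl` via `jln`; `σjm`, `σjn` via `jmn`; `σlm`, `σln`, `σmn` via `lmn`
  have hσjl' : ∀ y, σjl (Ξjln y) = Ξjln (ρjl j l n y) :=
    compat_of_restrict_of_restrict halg 𝔫' (isAffineOpen_inf₂ U b hb j l) _ h4jl inf_le_left inf_le_left le_jlm
      le_jln (isAffineOpen_inf₃ U b hb j l n) _ h4jln h𝔫 (ψ j l) (hΦjl j l m) (hΦjl j l n) hΞjlm hΞjln
      (hρjl j l m) (hρjl j l n) (hρjl𝔫 j l n) hσjl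
  have hσjm' : ∀ y, σjm (Ξjmn y) = Ξjmn (ρjl j m n y) :=
    compat_of_restrict_of_restrict halg 𝔫' (isAffineOpen_inf₂ U b hb j m) _ h4jm
      (le_inf (inf_le_left.trans inf_le_left) inf_le_right) inf_le_left le_jlm le_jmn
      (isAffineOpen_inf₃ U b hb j m n) _ h4jmn h𝔫 (ψ j m) (hΦjm j l m) (hΦjl j m n) hΞjlm hΞjmn
      (hρjm j l m) (hρjl j m n) (hρjl𝔫 j m n) hσjm
  have hσjn' : ∀ y, σjn (Ξjmn y) = Ξjmn (ρjm j m n y) :=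
    compat_of_restrict_of_restrict halg 𝔫' (isAffineOpen_inf₂ U b hb j n) _ h4jn
      (le_inf (inf_le_left.trans inf_le_left) inf_le_right) (le_inf (inf_le_left.trans inf_le_left) inf_le_right)
      le_jln le_jmn (isAffineOpen_inf₃ U b hb j m n) _ h4jmn h𝔫 (ψ j n) (hΦjm j l n) (hΦjm j m n) hΞjln hΞjmn
      (hρjm j l n) (hρjm j m n) (hρjm𝔫 j m n) hσjn
  have hσlm' : ∀ y, σlm (Ξlmn y) = Ξlmn (ρjl l m n y) :=
    compat_of_restrict_of_restrict halg 𝔫' (isAffineOpen_inf₂ U b hb l m) _ h4lm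
      (le_inf (inf_le_left.trans inf_le_right) inf_le_right) inf_le_left le_jlm le_lmn
      (isAffineOpen_inf₃ U b hb l m n) _ h4lmn h𝔫 (ψ l m) (hΦlm j l m) (hΦjl l m n) hΞjlm hΞlmn
      (hρlm j l m) (hρjl l m n) (hρjl𝔫 l m n) hσlm
  have hσln' : ∀ y, σln (Ξlmn y) = Ξlmn (ρjm l m n y) :=
    compat_of_restrict_of_restrict halg 𝔫' (isAffineOpen_inf₂ U b hb l n) _ h4ln
      (le_inf (inf_le_left.trans inf_le_right) inf_le_right) (le_inf (inf_le_left.trans inf_le_left) inf_le_right)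
      le_jln le_lmn (isAffineOpen_inf₃ U b hb l m n) _ h4lmn h𝔫 (ψ l n) (hΦlm j l n) (hΦjm l m n) hΞjln hΞlmn
      (hρlm j l n) (hρjm l m n) (hρjm𝔫 l m n) hσln
  have hσmn' : ∀ y, σmn (Ξlmn y) = Ξlmn (ρlm l m n y) :=
    compat_of_restrict_of_restrict halg 𝔫' (isAffineOpen_inf₂ U b hb m n) _ h4mn
      (le_inf (inf_le_left.trans inf_le_right) inf_le_right) (le_inf (inf_le_left.trans inf_le_right) inf_le_right)
      le_jmn le_lmn (isAffineOpen_inf₃ U b hb l m n) _ h4lmn h𝔫 (ψ m n) (hΦlm j m n) (hΦlm l m n) hΞjmn hΞlmn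
      (hρlm j m n) (hρlm l m n) (hρlm𝔫 l m n) hσmn
  -- the four restricted sections represent the four discrepancies over `W₄` (§3)
  have r_jlm := tangentSheaf_section_rep_restrict_discrepancy halg J hJ e (isAffineOpen_inf₃ U b hb j l m) _ h4jlm
    le_jlm (hθ j l m) hΞjlm hσjl hσlm hσjm
  have r_jln := tangentSheaf_section_rep_restrict_discrepancy halg J hJ e (isAffineOpen_inf₃ U b hb j l n) _ h4jln
    le_jln (hθ j l n) hΞjln hσjl' hσln hσjn
  have r_jmn := tangentSheaf_section_rep_restrict_discrepancy halg J hJ e (isAffineOpen_inf₃ U b hb j m n) _ h4jmn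
    le_jmn (hθ j m n) hΞjmn hσjm' hσmn hσjn'
  have r_lmn := tangentSheaf_section_rep_restrict_discrepancy halg J hJ e (isAffineOpen_inf₃ U b hb l m n) _ h4lmn
    le_lmn (hθ l m n) hΞlmn hσlm' hσmn' hσln'
  -- the ring-level cocycle identity, read on the sections (§5)
  have key := tangentSheaf_section_rep_cocycle J 𝔫' hJ hJ𝔫 e hW₄aff hσmn𝔫 (sub_mem_of_rep J e r_jlm)
    (sub_mem_of_rep J e r_jln) (sub_mem_of_rep J e r_jmn) (sub_mem_of_rep J e r_lmn) r_jlm r_jln r_jmn r_lmn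
  exact key

end Cocycle

/-! ## §6 Change of lifts: the cochain changes by a Čech coboundary -/

section ChangeOfLifts

variable (J 𝔫' : Ideal A') (hJ : J * J = ⊥) (hJ𝔫 : J * 𝔫' = ⊥) (e : ↥(J.restrictScalars k) ≃ₗ[k] k)

include halg hJ in
/-- **Restriction of the representing section, compatibility form**: if `θ` represents `u` over the affine `W₃`,
`W₄ = D(f) ⊆ W₃`, and `u_W` is compatible with `u` through the base change, then `θ|_{W₄}` represents `u_W`
(`u_W ≡ 1 (mod J)` is automatic: ★ F1 restriction with the nilpotent ideal `J` + uniqueness; §3).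
[cite: Hartshorne2010, Thm. 10.2 (proof), p. 81] -/
theorem tangentSheaf_section_rep_restrict' {W₃ W₄ : X.left.Opens} (hW₃ : IsAffineOpen W₃)
    (f : Γ(X.left, W₃)) (hW₄ : W₄ = X.left.basicOpen f) (h₄ : W₄ ≤ W₃)
    {u : A' ⊗[k] Γ(X.left, W₃) ≃ₐ[A'] A' ⊗[k] Γ(X.left, W₃)}
    {θ : (cotangentSheaf X).over W₃ ⟶ (unitModule X.left).over W₃}
    (hθ : ∀ c : Γ(X.left, W₃), u ((1 : A') ⊗ₜ c) =
        (1 : A') ⊗ₜ c + ((e.symm 1 : ↥(J.restrictScalars k)) : A') ⊗ₜ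
          (show Γ(X.left, W₃) from appLE θ (𝟙 W₃) (dSection X W₃ c)))
    {Φ₄ : A' ⊗[k] Γ(X.left, W₃) →ₐ[A'] A' ⊗[k] Γ(X.left, W₄)}
    (hΦ₄ : ∀ a s, Φ₄ (a ⊗ₜ s) = a ⊗ₜ X.left.presheaf.map (homOfLE h₄).op s)
    {uW : A' ⊗[k] Γ(X.left, W₄) ≃ₐ[A'] A' ⊗[k] Γ(X.left, W₄)} (huW : ∀ y, uW (Φ₄ y) = Φ₄ (u y)) :
    ∀ c : Γ(X.left, W₄), uW ((1 : A') ⊗ₜ c) =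
        (1 : A') ⊗ₜ c + ((e.symm 1 : ↥(J.restrictScalars k)) : A') ⊗ₜ
          (show Γ(X.left, W₄) from appLE (restrictHom (homOfLE h₄) θ) (𝟙 W₄) (dSection X W₄ c)) := by
  have hJnil : IsNilpotent J := ⟨2, by rw [pow_two, hJ]; rfl⟩
  obtain ⟨u', hu', hu'J⟩ := exists_algEquiv_restrict halg J hW₃ f hW₄ h₄ hJnil u (sub_mem_of_rep J e hθ) hΦ₄
  have heq : uW = u' := algEquiv_restrict_unique halg hW₃ f hW₄ h₄ u hΦ₄ huW hu'
  exact tangentSheaf_section_rep_restrict halg J hJ e hW₃ f hW₄ h₄ hθ hΦ₄ huW (heq ▸ hu'J)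

include hJ hJ𝔫 in
/-- **Change of lifts on one overlap ring, read on sections** (★ A3a §4 `infinitesimalAut_eq_discrepancy_modified`):
over an affine `W`, if `βᵢⱼ` represents `ρ'ᵢⱼ ρᵢⱼ⁻¹` (two lifts of the same datum), `ρ₂₃ ≡ 1 (mod 𝔫')`, and `θ`, `θ'`
represent the discrepancies of the `ρ`'s and of the `ρ'`'s, then `θ' − θ = β₂₃ − β₁₃ + β₁₂`.
[cite: Hartshorne2010, Thm. 10.2 (proof), p. 81 («the cocycle changes by a coboundary»)] -/
theorem tangentSheaf_section_rep_modified {W : X.left.Opens} (hW : IsAffineOpen W)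
    {ρ₁₂ ρ₂₃ ρ₁₃ ρ'₁₂ ρ'₂₃ ρ'₁₃ : A' ⊗[k] Γ(X.left, W) ≃ₐ[A'] A' ⊗[k] Γ(X.left, W)}
    (hρ₂₃ : ∀ x, ρ₂₃ x - x ∈ 𝔫' • (⊤ : Submodule A' (A' ⊗[k] Γ(X.left, W))))
    {β₁₂ β₂₃ β₁₃ θ θ' : (cotangentSheaf X).over W ⟶ (unitModule X.left).over W}
    (hβ₁₂ : ∀ c : Γ(X.left, W), (ρ'₁₂ * ρ₁₂⁻¹) ((1 : A') ⊗ₜ c) =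
        (1 : A') ⊗ₜ c + ((e.symm 1 : ↥(J.restrictScalars k)) : A') ⊗ₜ
          (show Γ(X.left, W) from appLE β₁₂ (𝟙 W) (dSection X W c)))
    (hβ₂₃ : ∀ c : Γ(X.left, W), (ρ'₂₃ * ρ₂₃⁻¹) ((1 : A') ⊗ₜ c) =
        (1 : A') ⊗ₜ c + ((e.symm 1 : ↥(J.restrictScalars k)) : A') ⊗ₜ
          (show Γ(X.left, W) from appLE β₂₃ (𝟙 W) (dSection X W c)))
    (hβ₁₃ : ∀ c : Γ(X.left, W), (ρ'₁₃ * ρ₁₃⁻¹) ((1 : A') ⊗ₜ c) =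
        (1 : A') ⊗ₜ c + ((e.symm 1 : ↥(J.restrictScalars k)) : A') ⊗ₜ
          (show Γ(X.left, W) from appLE β₁₃ (𝟙 W) (dSection X W c)))
    (hθ : ∀ c : Γ(X.left, W), (ρ₂₃ * ρ₁₂ * ρ₁₃⁻¹) ((1 : A') ⊗ₜ c) =
        (1 : A') ⊗ₜ c + ((e.symm 1 : ↥(J.restrictScalars k)) : A') ⊗ₜ
          (show Γ(X.left, W) from appLE θ (𝟙 W) (dSection X W c)))
    (hθ' : ∀ c : Γ(X.left, W), (ρ'₂₃ * ρ'₁₂ * ρ'₁₃⁻¹) ((1 : A') ⊗ₜ c) =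
        (1 : A') ⊗ₜ c + ((e.symm 1 : ↥(J.restrictScalars k)) : A') ⊗ₜ
          (show Γ(X.left, W) from appLE θ' (𝟙 W) (dSection X W c))) :
    θ' - θ = β₂₃ - β₁₃ + β₁₂ := by
  obtain ⟨b₁₂, hb₁₂⟩ := (exists_eq_infinitesimalAut_iff J hJ _).2 (sub_mem_of_rep J e hβ₁₂)
  obtain ⟨b₂₃, hb₂₃⟩ := (exists_eq_infinitesimalAut_iff J hJ _).2 (sub_mem_of_rep J e hβ₂₃)
  obtain ⟨b₁₃, hb₁₃⟩ := (exists_eq_infinitesimalAut_iff J hJ _).2 (sub_mem_of_rep J e hβ₁₃)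
  obtain ⟨D, hD⟩ := (exists_eq_infinitesimalAut_iff J hJ _).2 (sub_mem_of_rep J e hθ)
  have hcen : infinitesimalAut J hJ b₁₂ * ρ₂₃ = ρ₂₃ * infinitesimalAut J hJ b₁₂ :=
    infinitesimalAut_mul_comm J hJ hJ𝔫 ρ₂₃ hρ₂₃ b₁₂
  have hmod := infinitesimalAut_eq_discrepancy_modified J hJ (β₂₃ := b₂₃) (β₁₃ := b₁₃) hcen hD
  have e₁₂ : infinitesimalAut J hJ b₁₂ * ρ₁₂ = ρ'₁₂ := by rw [hb₁₂, inv_mul_cancel_right]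
  have e₂₃ : infinitesimalAut J hJ b₂₃ * ρ₂₃ = ρ'₂₃ := by rw [hb₂₃, inv_mul_cancel_right]
  have e₁₃ : infinitesimalAut J hJ b₁₃ * ρ₁₃ = ρ'₁₃ := by rw [hb₁₃, inv_mul_cancel_right]
  rw [e₁₂, e₂₃, e₁₃] at hmod
  have hD' := (rep_iff_forall_eq_tmul J hJ e hmod θ').1 hθ'
  have hDθ := (rep_iff_forall_eq_tmul J hJ e hD θ).1 hθ
  have hbβ₁₂ := (rep_iff_forall_eq_tmul J hJ e hb₁₂ β₁₂).1 hβ₁₂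
  have hbβ₂₃ := (rep_iff_forall_eq_tmul J hJ e hb₂₃ β₂₃).1 hβ₂₃
  have hbβ₁₃ := (rep_iff_forall_eq_tmul J hJ e hb₁₃ β₁₃).1 hβ₁₃
  have key : θ' = θ + β₁₂ + β₂₃ - β₁₃ := tangentSheaf_hom_ext_of_isAffineOpen hW fun c => by
    have hc := hD' c
    simp only [Derivation.sub_apply, Derivation.add_apply, hDθ c, hbβ₁₂ c, hbβ₂₃ c, hbβ₁₃ c, ← TensorProduct.add_tmul,
      ← TensorProduct.sub_tmul] at hc
    have hc' := tmul_symm_one_injective J e hc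
    change (show Γ(X.left, W) from appLE θ' (𝟙 W) (dSection X W c)) =
      (show Γ(X.left, W) from appLE (θ + β₁₂ + β₂₃ - β₁₃) (𝟙 W) (dSection X W c))
    rw [appLE_sub, appLE_add, appLE_add]
    exact hc'.symm
  rw [key]
  abel

variable {ι : Type u} (U : ι → X.left.affineOpens) (b : (j l : ι) → Γ(X.left, (U j).1))
  (hb : ∀ j l, (U j).1 ⊓ (U l).1 = X.left.basicOpen (b j l))

include halg hb hJ hJ𝔫 in
/-- **CHANGE OF LIFTS: `o⁽¹⁾ − o = d¹α`.** For two systems `ψ, ψ⁽¹⁾` of lifted transition automorphisms with `α j l`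
representing `ψ⁽¹⁾ j l (ψ j l)⁻¹` (they lift the same datum over `A'/J`), any obstruction cochains `o` of `ψ` and `o⁽¹⁾` of
`ψ⁽¹⁾` (§4) differ by the Čech coboundary of `α` — so the CLASS of `o` does not depend on the lifts.
[cite: Hartshorne2010, Thm. 10.2 (proof), p. 81] [cite: Hartshorne2010, Cor. 10.3, p. 82] -/
theorem obstructionCochain_sub_eq_cechMD1 (h𝔫 : IsNilpotent 𝔫')
    (ψ ψ₁ : (j l : ι) → A' ⊗[k] Γ(X.left, (U j).1 ⊓ (U l).1) ≃ₐ[A'] A' ⊗[k] Γ(X.left, (U j).1 ⊓ (U l).1))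
    (hψ : ∀ j l x, ψ j l x - x ∈ 𝔫' • (⊤ : Submodule A' (A' ⊗[k] Γ(X.left, (U j).1 ⊓ (U l).1))))
    (hψ₁ : ∀ j l x, ψ₁ j l x - x ∈ 𝔫' • (⊤ : Submodule A' (A' ⊗[k] Γ(X.left, (U j).1 ⊓ (U l).1))))
    (α : CechMC1 X.hom (tangentSheaf X) (fun j => (U j).1))
    (hα : ∀ (j l : ι) (c : Γ(X.left, (U j).1 ⊓ (U l).1)), (ψ₁ j l * (ψ j l)⁻¹) ((1 : A') ⊗ₜ c) =
        (1 : A') ⊗ₜ c + ((e.symm 1 : ↥(J.restrictScalars k)) : A') ⊗ₜ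
          (show Γ(X.left, (U j).1 ⊓ (U l).1) from appLE (α j l) (𝟙 _) (dSection X _ c)))
    (o o₁ : CechMC2 X.hom (tangentSheaf X) (fun j => (U j).1))
    (ho : ∀ (j l m : ι)
      (Φjl : A' ⊗[k] Γ(X.left, (U j).1 ⊓ (U l).1) →ₐ[A'] A' ⊗[k] Γ(X.left, (U j).1 ⊓ (U l).1 ⊓ (U m).1))
      (_ : ∀ a s, Φjl (a ⊗ₜ s) = a ⊗ₜ X.left.presheaf.map (homOfLE inf_le_left).op s)
      (Φlm : A' ⊗[k] Γ(X.left, (U l).1 ⊓ (U m).1) →ₐ[A'] A' ⊗[k] Γ(X.left, (U j).1 ⊓ (U l).1 ⊓ (U m).1))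
      (_ : ∀ a s, Φlm (a ⊗ₜ s) = a ⊗ₜ X.left.presheaf.map
        (homOfLE (le_inf (inf_le_left.trans inf_le_right) inf_le_right)).op s)
      (Φjm : A' ⊗[k] Γ(X.left, (U j).1 ⊓ (U m).1) →ₐ[A'] A' ⊗[k] Γ(X.left, (U j).1 ⊓ (U l).1 ⊓ (U m).1))
      (_ : ∀ a s, Φjm (a ⊗ₜ s) = a ⊗ₜ X.left.presheaf.map
        (homOfLE (le_inf (inf_le_left.trans inf_le_left) inf_le_right)).op s)
      (ρjl ρlm ρjm : A' ⊗[k] Γ(X.left, (U j).1 ⊓ (U l).1 ⊓ (U m).1) ≃ₐ[A']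
        A' ⊗[k] Γ(X.left, (U j).1 ⊓ (U l).1 ⊓ (U m).1)),
      (∀ x, ρjl (Φjl x) = Φjl (ψ j l x)) → (∀ x, ρlm (Φlm x) = Φlm (ψ l m x)) →
      (∀ x, ρjm (Φjm x) = Φjm (ψ j m x)) →
      ∀ c : Γ(X.left, (U j).1 ⊓ (U l).1 ⊓ (U m).1), (ρlm * ρjl * ρjm⁻¹) ((1 : A') ⊗ₜ c) =
        (1 : A') ⊗ₜ c + ((e.symm 1 : ↥(J.restrictScalars k)) : A') ⊗ₜ
          (show Γ(X.left, (U j).1 ⊓ (U l).1 ⊓ (U m).1) from appLE (o j l m) (𝟙 _) (dSection X _ c)))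
    (ho₁ : ∀ (j l m : ι)
      (Φjl : A' ⊗[k] Γ(X.left, (U j).1 ⊓ (U l).1) →ₐ[A'] A' ⊗[k] Γ(X.left, (U j).1 ⊓ (U l).1 ⊓ (U m).1))
      (_ : ∀ a s, Φjl (a ⊗ₜ s) = a ⊗ₜ X.left.presheaf.map (homOfLE inf_le_left).op s)
      (Φlm : A' ⊗[k] Γ(X.left, (U l).1 ⊓ (U m).1) →ₐ[A'] A' ⊗[k] Γ(X.left, (U j).1 ⊓ (U l).1 ⊓ (U m).1))
      (_ : ∀ a s, Φlm (a ⊗ₜ s) = a ⊗ₜ X.left.presheaf.map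
        (homOfLE (le_inf (inf_le_left.trans inf_le_right) inf_le_right)).op s)
      (Φjm : A' ⊗[k] Γ(X.left, (U j).1 ⊓ (U m).1) →ₐ[A'] A' ⊗[k] Γ(X.left, (U j).1 ⊓ (U l).1 ⊓ (U m).1))
      (_ : ∀ a s, Φjm (a ⊗ₜ s) = a ⊗ₜ X.left.presheaf.map
        (homOfLE (le_inf (inf_le_left.trans inf_le_left) inf_le_right)).op s)
      (ρjl ρlm ρjm : A' ⊗[k] Γ(X.left, (U j).1 ⊓ (U l).1 ⊓ (U m).1) ≃ₐ[A']
        A' ⊗[k] Γ(X.left, (U j).1 ⊓ (U l).1 ⊓ (U m).1)),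
      (∀ x, ρjl (Φjl x) = Φjl (ψ₁ j l x)) → (∀ x, ρlm (Φlm x) = Φlm (ψ₁ l m x)) →
      (∀ x, ρjm (Φjm x) = Φjm (ψ₁ j m x)) →
      ∀ c : Γ(X.left, (U j).1 ⊓ (U l).1 ⊓ (U m).1), (ρlm * ρjl * ρjm⁻¹) ((1 : A') ⊗ₜ c) =
        (1 : A') ⊗ₜ c + ((e.symm 1 : ↥(J.restrictScalars k)) : A') ⊗ₜ
          (show Γ(X.left, (U j).1 ⊓ (U l).1 ⊓ (U m).1) from appLE (o₁ j l m) (𝟙 _) (dSection X _ c))) :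
    o₁ - o = cechMD1 X.hom (tangentSheaf X) (fun j => (U j).1) α := by
  funext j l m
  rw [Pi.sub_apply, cechMD1_apply]
  -- the three principal-open facts and base changes for this triple
  have hW₃jl : (U j).1 ⊓ (U l).1 ⊓ (U m).1 =
      X.left.basicOpen (X.left.presheaf.map (homOfLE (inf_le_left : (U j).1 ⊓ (U l).1 ≤ (U j).1)).op (b j m)) :=
    inf_eq_basicOpen_map U b hb inf_le_left m
  have hW₃lm : (U j).1 ⊓ (U l).1 ⊓ (U m).1 =
      X.left.basicOpen (X.left.presheaf.map (homOfLE (inf_le_left : (U l).1 ⊓ (U m).1 ≤ (U l).1)).op (b l j)) := by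
    rw [← inf_eq_basicOpen_map U b hb inf_le_left j]
    ac_rfl
  have hW₃jm : (U j).1 ⊓ (U l).1 ⊓ (U m).1 =
      X.left.basicOpen (X.left.presheaf.map (homOfLE (inf_le_left : (U j).1 ⊓ (U m).1 ≤ (U j).1)).op (b j l)) := by
    rw [← inf_eq_basicOpen_map U b hb inf_le_left l]
    ac_rfl
  have hW₃aff : IsAffineOpen ((U j).1 ⊓ (U l).1 ⊓ (U m).1) := isAffineOpen_inf₃ U b hb j l m
  obtain ⟨Φjl, hΦjl⟩ := exists_baseChangeMap (A' := A') halg ((U j).1 ⊓ (U l).1) ((U j).1 ⊓ (U l).1 ⊓ (U m).1)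
    inf_le_left
  obtain ⟨Φlm, hΦlm⟩ := exists_baseChangeMap (A' := A') halg ((U l).1 ⊓ (U m).1) ((U j).1 ⊓ (U l).1 ⊓ (U m).1)
    (le_inf (inf_le_left.trans inf_le_right) inf_le_right)
  obtain ⟨Φjm, hΦjm⟩ := exists_baseChangeMap (A' := A') halg ((U j).1 ⊓ (U m).1) ((U j).1 ⊓ (U l).1 ⊓ (U m).1)
    (le_inf (inf_le_left.trans inf_le_left) inf_le_right)
  -- restrictions of both systems
  obtain ⟨ρjl, hρjl, -⟩ := exists_algEquiv_restrict halg 𝔫' (isAffineOpen_inf₂ U b hb j l) _ hW₃jl inf_le_left h𝔫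
    (ψ j l) (hψ j l) hΦjl
  obtain ⟨ρlm, hρlm, hρlm𝔫⟩ := exists_algEquiv_restrict halg 𝔫' (isAffineOpen_inf₂ U b hb l m) _ hW₃lm
    (le_inf (inf_le_left.trans inf_le_right) inf_le_right) h𝔫 (ψ l m) (hψ l m) hΦlm
  obtain ⟨ρjm, hρjm, -⟩ := exists_algEquiv_restrict halg 𝔫' (isAffineOpen_inf₂ U b hb j m) _ hW₃jm
    (le_inf (inf_le_left.trans inf_le_left) inf_le_right) h𝔫 (ψ j m) (hψ j m) hΦjm
  obtain ⟨ρ'jl, hρ'jl, -⟩ := exists_algEquiv_restrict halg 𝔫' (isAffineOpen_inf₂ U b hb j l) _ hW₃jl inf_le_left h𝔫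
    (ψ₁ j l) (hψ₁ j l) hΦjl
  obtain ⟨ρ'lm, hρ'lm, -⟩ := exists_algEquiv_restrict halg 𝔫' (isAffineOpen_inf₂ U b hb l m) _ hW₃lm
    (le_inf (inf_le_left.trans inf_le_right) inf_le_right) h𝔫 (ψ₁ l m) (hψ₁ l m) hΦlm
  obtain ⟨ρ'jm, hρ'jm, -⟩ := exists_algEquiv_restrict halg 𝔫' (isAffineOpen_inf₂ U b hb j m) _ hW₃jm
    (le_inf (inf_le_left.trans inf_le_left) inf_le_right) h𝔫 (ψ₁ j m) (hψ₁ j m) hΦjm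
  -- the `α`'s restricted represent `ρ' ρ⁻¹` (§6 compatibility form of §3)
  have rjl := tangentSheaf_section_rep_restrict' halg J hJ e (isAffineOpen_inf₂ U b hb j l) _ hW₃jl inf_le_left
    (hα j l) hΦjl (algEquiv_restrict_mul hρ'jl (algEquiv_restrict_inv hρjl))
  have rlm := tangentSheaf_section_rep_restrict' halg J hJ e (isAffineOpen_inf₂ U b hb l m) _ hW₃lm
    (le_inf (inf_le_left.trans inf_le_right) inf_le_right) (hα l m) hΦlm
    (algEquiv_restrict_mul hρ'lm (algEquiv_restrict_inv hρlm))
  have rjm := tangentSheaf_section_rep_restrict' halg J hJ e (isAffineOpen_inf₂ U b hb j m) _ hW₃jm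
    (le_inf (inf_le_left.trans inf_le_left) inf_le_right) (hα j m) hΦjm
    (algEquiv_restrict_mul hρ'jm (algEquiv_restrict_inv hρjm))
  -- the two discrepancies are represented by `o j l m`, `o₁ j l m`
  have hθ := ho j l m Φjl hΦjl Φlm hΦlm Φjm hΦjm ρjl ρlm ρjm hρjl hρlm hρjm
  have hθ₁ := ho₁ j l m Φjl hΦjl Φlm hΦlm Φjm hΦjm ρ'jl ρ'lm ρ'jm hρ'jl hρ'lm hρ'jm
  exact tangentSheaf_section_rep_modified J 𝔫' hJ hJ𝔫 e hW₃aff hρlm𝔫 rjl rlm rjm hθ hθ₁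

end ChangeOfLifts

end Literature.AlgebraicGeometry.Deformation

end
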